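import Summits.Parity.GeneralizedHardyLittlewood.Theses.LeeYangFibres
import Summits.Parity.GeneralizedHardyLittlewood.Theorems.LeeYangFibresRelativeDimOneTypeClassMoments
import Summits.Parity.GeneralizedHardyLittlewood.Theorems.LeeYangFibresRelativeDimOneTypeRigidity
import Summits.Parity.GeneralizedHardyLittlewood.Theorems.LeeYangFibresRelativeDimOneTypeSingularWeights
import Summits.Parity.GeneralizedHardyLittlewood.Theorems.LeeYangFibresRelativeDimOneTypeData
import Summits.Parity.GeneralizedHardyLittlewood.Theorems.LeeYangFibresRelativeDimOneTypeEndgame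
import Summits.Parity.GeneralizedHardyLittlewood.Theorems.LeeYangFibresRelativeDimOneSplitBandlimited
import Summits.Parity.GeneralizedHardyLittlewood.Theorems.LeeYangFibresRelativeDimOneLatticeNecessity
import Summits.Parity.GeneralizedHardyLittlewood.Theorems.LeeYangFibresRelativeDimOneHardness
import Summits.Parity.GeneralizedHardyLittlewood.Theorems.LeeYangFibresCellParityLawSingularRatio
import Summits.Parity.GeneralizedHardyLittlewood.Theorems.LeeYangFibresAbsoluteUpgradeSlices
import Summits.Parity.GeneralizedHardyLittlewood.Theorems.RelativeDimOne.Negative.RelativeDimOneLoadBearing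
import Summits.Parity.GeneralizedHardyLittlewood.Theorems.RelativeDimOne.Negative.RelativeDimOneLoadBearingTwo
import Summits.Parity.GeneralizedHardyLittlewood.Theorems.RelativeDimOne.Negative.RelativeDimOneRepeatedForm
import Summits.Parity.GeneralizedHardyLittlewood.Theorems.RelativeDimOne.Negative.RelativeDimOneLogSlack
import HarnessLib

/-!
# Route `LeeYangFibres`, crux `RelativeDimOne` (stmt-Parity-14113): the TYPE-CONDITIONED SPLIT, assembled —
# `RelativeDimOne ↔ (IncidenceBandlimitedCoreDecay (1/4) ∧ LowClassSecondMoment (1/3))`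

Line `gallagher-backwards-split` (reshaped by lead seat c1, skeleton `Cruxes/RelativeDimOne/Lines/gallagher_backwards_split_c1.lean`).
The five provable stubs of the reshaped skeleton are LANDED (`stub_typeClassMoments` p117562, `stub_typeRigidity`,
`stub_singularWeights` p119458, `stub_typeData` p119410, `stub_endgame` p116137); this file composes them BY NAME into
the deduction of the crux from the two atoms (`relativeDimOne_of_atoms`, = the skeleton's `RelativeDimOne_of` fed with
the landed stubs) and proves the converse (both atoms are NECESSARY: `coreDecay_of_relativeDimOne`, sorry-free here;
`lowClassSecondMoment_of_relativeDimOne` via the landed `latticeNecessity`). Net result, kernel-checked: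

  `RelativeDimOne ↔ (IncidenceBandlimitedCoreDecay (1/4) ∧ LowClassSecondMoment (1/3))`

— the uniform `d = 1` Hardy–Littlewood conjecture with Green–Tao's Conj. 1.4 error is EXACTLY the conjunction of
(P′) the existence, at each scale, of a squarefree-supported, type-invariant, Hardy–Littlewood-decaying incidence
spectrum of level `N^{1/4}` reproducing every `S(Ψ, K)` to relative accuracy, and (L) the sharp class second moment
`Σ_a ψ(N;q,a)² ≤ (1+ε)(N²/φ(q) + N log N)` for `q ≤ N^{1/3}` (GRH-lite). The crux item stays OPEN (both atoms are
open problems); this file is its reduction; `relativeDimOne_iff_general` records it at ARBITRARY levels `0 < θ < 1`,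
`0 < θ₁ ≤ 1` (the `L`-atom may be taken at any positive level).

Why the original line needed the reshape, and the mechanism of the new one (type cells; one-deviation terms collapse
to the global PNT by the unit-scaling symmetry of the cell; CRT rigidity with mean weight `O(t⁴/p²)` at rough primes):
see the skeleton header and `Theorems/LeeYangFibresRelativeDimOneTypeDefs.lean`.
-/

noncomputable section

open scoped BigOperators Classical Topology
open Finset Filter MeasureTheory Literature.NumberTheory.Sieve
open Summit.Parity.GeneralizedHardyLittlewood.Theses.LeeYangFibres (RelativeDimOne)
open Summit.Parity.GeneralizedHardyLittlewood.Cruxes.RelativeDimOne.GallagherBackwards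
open Summit.Parity.GeneralizedHardyLittlewood.Cruxes.RelativeDimOne.GallagherBackwardsSplit
open Summit.Parity.GeneralizedHardyLittlewood.Cruxes.CellParityLaw.SectionAnnihilator.SingularRatio
  (singularProduct_nonneg)
open Summit.Parity.GeneralizedHardyLittlewood.Theorems.AbsoluteUpgrade (archFactor_le_two_mul)

namespace Summit.Parity.GeneralizedHardyLittlewood.Cruxes.RelativeDimOne.TypeSplit

/-! ### The composition -/

/-- **The crux from the stubs** (hypothesis form; concludes `LeeYangFibres.RelativeDimOne` BY NAME): core with decay at
level `1/4`, class second moment at level `1/3` feeding type-class moments at level `3/10`, rigidity, weights, type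
data at level `1/4`, endgame. -/
theorem RelativeDimOne_of :
    IncidenceBandlimitedCoreDecay (1 / 4) → LowClassSecondMoment (1 / 3) →
    (∀ θ₁ θ₁' : ℝ, θ₁' < θ₁ → θ₁ < 1 → LowClassSecondMoment θ₁ → TypeClassMoments θ₁') →
    TypeRigidity → SingularWeightFacts →
    (∀ θ θ₁ : ℝ, 0 < θ → θ < 1 → 0 < θ₁ →
      TypeClassMoments θ₁ → SingularWeightFacts → TypeRigidity → TypeData θ) →
    (∀ θ : ℝ, 0 < θ → θ < 1 → Endgame θ) → RelativeDimOne :=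
  fun hP hL hMom hRig hW hData hEnd =>
    hEnd (1 / 4) (by norm_num) (by norm_num) hP
      (hData (1 / 4) (3 / 10) (by norm_num) (by norm_num) (by norm_num)
        (hMom (1 / 3) (3 / 10) (by norm_num) (by norm_num) hL) hW hRig)
      hRig hW

/-- **The crux from the two atoms**: the skeleton's composition `RelativeDimOne_of` fed with the five LANDED provable
stubs. -/
theorem relativeDimOne_of_atoms (hP : IncidenceBandlimitedCoreDecay (1 / 4)) (hL : LowClassSecondMoment (1 / 3)) :
    RelativeDimOne :=
  RelativeDimOne_of hP hL stub_typeClassMoments stub_typeRigidity stub_singularWeights stub_typeData stub_endgame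

/-! ### Sorry-free certificates: both atoms are NECESSARY for the crux -/

/-- Atom L is a restriction of the tree's `SharpClassSecondMoment`. -/
theorem lowClassSecondMoment_of_sharp {θ₁ : ℝ} (hθ : θ₁ ≤ 1) (h : SharpClassSecondMoment) :
    LowClassSecondMoment θ₁ := by
  intro ε hε
  obtain ⟨N₀, hN₀⟩ := h ε hε
  refine ⟨max N₀ 1, fun N hN q hq hqN => hN₀ N (le_of_max_le_left hN) q hq ?_⟩
  have hN1 : (1 : ℝ) ≤ N := by exact_mod_cast le_of_max_le_right hN
  have hqR : (q : ℝ) ≤ N :=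
    calc (q : ℝ) ≤ (N : ℝ) ^ θ₁ := hqN
      _ ≤ (N : ℝ) ^ (1 : ℝ) := Real.rpow_le_rpow_of_exponent_le hN1 hθ
      _ = N := Real.rpow_one _
  exact_mod_cast hqR

/-- **Atom L is necessary**: the crux implies the class second moment at every level `θ₁ ≤ 1` (Gallagher's identity
backwards, `latticeNecessity` p92797). -/
theorem lowClassSecondMoment_of_relativeDimOne {θ₁ : ℝ} (hθ : θ₁ ≤ 1) :
    RelativeDimOne → LowClassSecondMoment θ₁ :=
  fun h => lowClassSecondMoment_of_sharp hθ (latticeNecessity (upperRelativeDimOne_of_relativeDimOne h))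

/-- The squarefree band sum of the singular-series spectrum of `Ψ = sys a b` is the truncated squarefree Euler
expansion of `𝔖(Ψ)`. -/
theorem sfBand_hlCoeff {t : ℕ} (Q : ℕ) (Ψ : Fin t → AffLinForm 1) :
    sfBand Q (fun q b => hlCoeff q (coeffs Ψ) b) (consts Ψ) =
      ∑ q ∈ (Finset.Icc 1 Q).filter Squarefree, ∏ p ∈ q.primeFactors, (localFactor Ψ p - 1) := by
  unfold sfBand hlCoeff
  simp only [sys_coeffs_consts]

open BandlimitedProof in
/-- **Atom P′ is necessary**: the crux gives the incidence-bandlimited core WITH DECAY at every level `θ > 0`, with the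
singular-series spectrum `hlCoeff` (type-invariant, decay constant `1`) and the landed uniform Euler tail. -/
theorem coreDecay_of_relativeDimOne {θ : ℝ} (hθ : 0 < θ) (hR : RelativeDimOne) :
    IncidenceBandlimitedCoreDecay θ := by
  intro t L ht
  refine ⟨1, one_pos, fun ε hε => ?_⟩
  have hε₁ : (0 : ℝ) < min 1 (ε / 8) := lt_min one_pos (by linarith)
  have hε₁1 : min 1 (ε / 8) ≤ 1 := min_le_left _ _
  have hε₁8 : min 1 (ε / 8) ≤ ε / 8 := min_le_right _ _
  have hε₂ : (0 : ℝ) < min 1 (ε / 4) := lt_min one_pos (by linarith)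
  have hε₂1 : min 1 (ε / 4) ≤ 1 := min_le_left _ _
  have hε₂4 : min 1 (ε / 4) ≤ ε / 4 := min_le_right _ _
  obtain ⟨N₁, hN₁⟩ := abs_sub_sum_squarefree_le t L hθ hε₁
  obtain ⟨N₂, hN₂⟩ := hR t L ht (min 1 (ε / 4)) hε₂
  refine ⟨max N₁ N₂, fun N hN => ?_⟩
  refine ⟨fun a q b => hlCoeff q a b, fun a => EndgameProof.typeInvariant_hl a, fun a => EndgameProof.hasDecay_hl a,
    fun Ψ hΨ hL K hK hKN => ?_⟩
  have hSG := ((hN₁ N (le_of_max_le_left hN)) Ψ hΨ hL).2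
  rw [← sfBand_hlCoeff (level θ N) Ψ] at hSG
  have hS0 : 0 ≤ singularProduct Ψ := singularProduct_nonneg hΨ
  set G := sfBand (level θ N) (fun q b => hlCoeff q (coeffs Ψ) b) (consts Ψ) with hGdef
  set 𝔖 := singularProduct Ψ with h𝔖def
  have hGabs : |G| ≤ 𝔖 + min 1 (ε / 8) := by
    have h1 : |G| - |𝔖| ≤ |G - 𝔖| := abs_sub_abs_le_abs_sub G 𝔖
    rw [abs_sub_comm] at h1
    rw [abs_of_nonneg hS0] at h1
    linarith
  have hSleG : 𝔖 ≤ |G| + min 1 (ε / 8) := by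
    have h1 : |𝔖| - |G| ≤ |𝔖 - G| := abs_sub_abs_le_abs_sub 𝔖 G
    rw [abs_of_nonneg hS0] at h1
    linarith
  have hcrux := hN₂ N (le_of_max_le_right hN) Ψ hΨ hL K hK hKN
  have hA0 : 0 ≤ archFactor Ψ K := by
    unfold archFactor
    exact ENNReal.toReal_nonneg
  have hA2 : archFactor Ψ K ≤ 2 * (N : ℝ) := archFactor_le_two_mul Ψ hKN
  set A := archFactor Ψ K with hAdef
  set S := vonMangoldtSum Ψ K N with hSdef
  have hN0 : (0 : ℝ) ≤ N := Nat.cast_nonneg N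
  have hGa0 : 0 ≤ |G| := abs_nonneg G
  have h1 : |S - A * G| ≤ |S - A * 𝔖| + A * |𝔖 - G| := by
    have hsplit : S - A * G = (S - A * 𝔖) + A * (𝔖 - G) := by ring
    calc |S - A * G| = |(S - A * 𝔖) + A * (𝔖 - G)| := by rw [hsplit]
      _ ≤ |S - A * 𝔖| + |A * (𝔖 - G)| := abs_add_le _ _
      _ = |S - A * 𝔖| + A * |𝔖 - G| := by rw [abs_mul, abs_of_nonneg hA0]
  have h2 : A * |𝔖 - G| ≤ A * min 1 (ε / 8) := mul_le_mul_of_nonneg_left hSG hA0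
  have h3 : A * 𝔖 ≤ A * |G| + A * min 1 (ε / 8) := by
    have := mul_le_mul_of_nonneg_left hSleG hA0
    rw [mul_add] at this
    exact this
  have h4 : min 1 (ε / 4) * (A * 𝔖) ≤ min 1 (ε / 4) * (A * |G| + A * min 1 (ε / 8)) :=
    mul_le_mul_of_nonneg_left h3 hε₂.le
  have hX0 : 0 ≤ A * |G| := mul_nonneg hA0 hGa0
  have h5 : min 1 (ε / 4) * (A * |G|) ≤ ε * (A * |G|) :=
    mul_le_mul_of_nonneg_right (hε₂4.trans (by linarith)) hX0
  have hY0 : 0 ≤ A * min 1 (ε / 8) := mul_nonneg hA0 hε₁.le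
  have h6 : min 1 (ε / 4) * (A * min 1 (ε / 8)) ≤ 1 * (A * min 1 (ε / 8)) :=
    mul_le_mul_of_nonneg_right hε₂1 hY0
  have h7 : A * min 1 (ε / 8) ≤ 2 * (N : ℝ) * min 1 (ε / 8) :=
    mul_le_mul_of_nonneg_right hA2 hε₁.le
  have h8 : (N : ℝ) * min 1 (ε / 8) ≤ (N : ℝ) * (ε / 8) := mul_le_mul_of_nonneg_left hε₁8 hN0
  have h9 : min 1 (ε / 4) * (N : ℝ) ≤ (ε / 4) * N := mul_le_mul_of_nonneg_right hε₂4 hN0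
  have hc' : |S - A * 𝔖| ≤ min 1 (ε / 4) * (A * 𝔖) + min 1 (ε / 4) * N := by
    have := hcrux
    rw [mul_add] at this
    exact this
  calc |S - A * G| ≤ |S - A * 𝔖| + A * |𝔖 - G| := h1
    _ ≤ ε * (A * |G| + N) := by nlinarith [h2, h3, h4, h5, h6, h7, h8, h9, hc', hX0, hY0, hN0, hε.le]

/-- **THE REDUCTION** (registered hook): the crux `RelativeDimOne` is EQUIVALENT to the conjunction of the two atoms of
the reshaped line — the decaying incidence-bandlimited core at level `N^{1/4}` and the class second moment at level
`N^{1/3}`. -/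
theorem relativeDimOne_iff_coreDecay_and_lowSecondMoment : RelativeDimOne ↔ (IncidenceBandlimitedCoreDecay (1 / 4) ∧ LowClassSecondMoment (1 / 3)) :=
  ⟨fun h => ⟨coreDecay_of_relativeDimOne (by norm_num) h, lowClassSecondMoment_of_relativeDimOne (by norm_num) h⟩,
    fun h => relativeDimOne_of_atoms h.1 h.2⟩

/-- `LowClassSecondMoment` is monotone in the level (a smaller level is a weaker statement). -/
theorem lowClassSecondMoment_mono {θ₁ θ₁' : ℝ} (h : θ₁' ≤ θ₁) :
    LowClassSecondMoment θ₁ → LowClassSecondMoment θ₁' := by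
  intro hL ε hε
  obtain ⟨N₀, hN₀⟩ := hL ε hε
  refine ⟨max N₀ 1, fun N hN q hq hqN => hN₀ N (le_of_max_le_left hN) q hq (hqN.trans ?_)⟩
  exact Real.rpow_le_rpow_of_exponent_le (by exact_mod_cast le_of_max_le_right hN) h

/-- **The crux from the two atoms at ARBITRARY levels** `0 < θ < 1`, `θ₁ > 0`: the landed stubs are uniform in the
levels (type-class moments at level `min θ₁ ½ / 2`, data with `D` large). -/
theorem relativeDimOne_of_atoms_general {θ θ₁ : ℝ} (hθ0 : 0 < θ) (hθ1 : θ < 1) (hθ₁ : 0 < θ₁)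
    (hP : IncidenceBandlimitedCoreDecay θ) (hL : LowClassSecondMoment θ₁) : RelativeDimOne := by
  have hθ₂ : 0 < min θ₁ (1 / 2) := lt_min hθ₁ (by norm_num)
  have hθ₃ : min θ₁ (1 / 2) < 1 := lt_of_le_of_lt (min_le_right _ _) (by norm_num)
  have hL' : LowClassSecondMoment (min θ₁ (1 / 2)) := lowClassSecondMoment_mono (min_le_left _ _) hL
  exact stub_endgame θ hθ0 hθ1 hP
    (stub_typeData θ (min θ₁ (1 / 2) / 2) hθ0 hθ1 (by positivity)
      (stub_typeClassMoments (min θ₁ (1 / 2)) (min θ₁ (1 / 2) / 2) (by linarith) hθ₃ hL')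
      stub_singularWeights stub_typeRigidity)
    stub_typeRigidity stub_singularWeights

/-- **THE REDUCTION AT ARBITRARY LEVELS**: for all `0 < θ < 1` and `0 < θ₁ ≤ 1`,
`RelativeDimOne ↔ (IncidenceBandlimitedCoreDecay θ ∧ LowClassSecondMoment θ₁)` — in particular the `L`-atom may be
taken at any positive level `N^{θ₁}`. -/
theorem relativeDimOne_iff_general {θ θ₁ : ℝ} (hθ0 : 0 < θ) (hθ1 : θ < 1) (hθ₁ : 0 < θ₁) (hθ₁1 : θ₁ ≤ 1) :
    RelativeDimOne ↔ (IncidenceBandlimitedCoreDecay θ ∧ LowClassSecondMoment θ₁) :=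
  ⟨fun h => ⟨coreDecay_of_relativeDimOne hθ0 h, lowClassSecondMoment_of_relativeDimOne hθ₁1 h⟩,
    fun h => relativeDimOne_of_atoms_general hθ0 hθ1 hθ₁ h.1 h.2⟩

/-! ### §Disproof — the landed Negative lemmas of this crux, checked against the reshaped stubs

Each deleted hypothesis of the disprover's load-bearing witnesses is KEPT by the reshaped statements
(`CoreApprox`: `affLinSize Ψ N ≤ L`, `K ⊆ realBox 1 N`, `Convex ℝ K`, `IsNondegenerateSystem Ψ`; every `N₀` comes after
`L` and `ε`; the `+ εN` slack is kept). -/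

section DisproofCompatibility
open Summit.Parity.GeneralizedHardyLittlewood.Theorems.RelativeDimOne.Negative

example : ¬ RelativeDimOneWithoutSize := relativeDimOne_false_without_size
example : ¬ RelativeDimOneWithoutBox := relativeDimOne_false_without_box
example : ¬ RelativeDimOneWithoutConvex := relativeDimOne_false_without_convex
example : ¬ RelativeDimOneWithoutNondegenerate := relativeDimOne_false_without_nondegenerate
example : ¬ RelativeDimOneWithoutNonproportional := relativeDimOne_false_without_nonproportional
example : ¬ PurelyRelativeDimOne := not_purelyRelativeDimOne
example : ¬ RelativeDimOneLogSlack := not_relativeDimOneLogSlack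
example : ¬ RelativeDimOneUniformInSize := not_relativeDimOneUniformInSize

end DisproofCompatibility

end Summit.Parity.GeneralizedHardyLittlewood.Cruxes.RelativeDimOne.TypeSplit

end
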